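import Literature.AlgebraicGeometry.AbelianSchemes.AbelianSchemeOverGlueDataPolarization
import Literature.AlgebraicGeometry.AbelianSchemes.PolarizationUnitHypothesis
import HarnessLib

/-!
# Gluing polarised triples over a REDUCED locally Noetherian base: only the normalisation of `𝒫₀` remains
# (sequel of ★ FILE B/A2/C of hand (h7) + ★ `PolarizationUnitHypothesis`)

Topic `AlgebraicGeometry/AbelianSchemes`; namespaces `…AbelianSchemeOver.ZariskiGluingDatum.PolarizationChartDatum` and
`…AbelianSchemeOver.CocycleDatum`.  Cell hodgecm-mathlib (D-0151), hand (h7)(D-F3), consumer F-8 (8c).  THEOREMS ONLY (no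
def, no instance, no notation, no `sorry`).  ★ FILE B `PolarizationChartDatum.toPolarizationDatum` / ★ A2
`hĜ_of_isLocallyNoetherian_base` / ★ FILE C `CocycleDatum.glueTriple … D₀ … unit₀ unit` carry the unit hypotheses
`unit₀ : 𝒫₀|_{Z × {ε_Ẑ}} ≅ 𝒪` and `unit i : 𝒫ᵢ|_{Aᵢ × {ε_{Âᵢ}}} ≅ 𝒪` as binders; ★ `Polarization.nonempty_unitHatSlice_iso`
(HECKE-LINK H2, [MumfordAV1970, §5 Cor. 6] via the universal property of the dual pair) discharges the latter from the
chart polarisations over REDUCED charts.  This file records the composites for the consumer: over a reduced locally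
Noetherian base / reduced locally Noetherian slices (open subschemes inherit both — Mathlib `isReduced_of_isOpenImmersion`,
`isLocallyNoetherian_of_isOpenImmersion`) the charts of duals `Ĝᵢ`, the glued polarisation, the glued triple and its
CARTESIAN CHARTS need only `unit₀`, the normalisation of the Poincaré sheaf of `D₀` along `Z × {ε_Ẑ}`
([MumfordFogartyKirwan1994, Ch. 6 §2 p. 121]), which the construction of `D₀` (F-3, [MumfordFogartyKirwan1994, Cor. 6.8])
supplies.

* §1 (`ZariskiGluingDatum.PolarizationChartDatum`) `unit_of_isReduced`, **`hĜ_of_isReduced_of_isLocallyNoetherian`**,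
  `pol_lam_left_comp_Ĝ_of_isReduced`;
* §2 (`CocycleDatum`) `unit_of_isReduced`, `isReduced_U`, `isLocallyNoetherian_U`, `pol_lam_left_comp_Ĝ_of_isReduced`,
  **`isBaseChangeVia_chartTriple_of_isReduced`** (its dual clause is ★ FILE C `hat_isBaseChangeVia_Ĝ … unit₀ (unit_of_isReduced …)`) — cartesian charts of
  `glueTriple … unit₀ (unit_of_isReduced …)`.

HC_CM is proved only modulo the printed citations until rung 0 closes; this file discharges none of them.

## References
* [MumfordFogartyKirwan1994] D. Mumford, J. Fogarty, F. Kirwan, *Geometric Invariant Theory*, 3rd ed. (1994), Ch. 6 §1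
  Cor. 6.4 (p. 117), Cor. 6.8 (p. 118); §2 (p. 121), Def. 6.2–6.3 (p. 120); Ch. 7 §2 Def. 7.2 (p. 129), Def. 7.3 (p. 129).
* [MumfordAV1970] D. Mumford, *Abelian Varieties* (1970), §5 Cor. 6 (p. 54).
* [MilneAV2008] J. S. Milne, *Abelian Varieties* (v2.00, 2008), I §8 pp. 36–37.
* [StacksProject] The Stacks Project, Tag 01LH (Relative glueing).
-/

universe u

open CategoryTheory CategoryTheory.Limits AlgebraicGeometry MonoidalCategory

noncomputable section

namespace Literature.AlgebraicGeometry.AbelianSchemes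

namespace AbelianSchemeOver

open scoped MonObj

variable {S : Scheme.{u}}

/-! ### §1 Over a Zariski gluing datum: chart unit hypotheses and `hĜ` over a reduced locally Noetherian base -/

namespace ZariskiGluingDatum

namespace PolarizationChartDatum

variable {𝔇 : ZariskiGluingDatum S} (𝔔 : PolarizationChartDatum 𝔇) (D₀ : 𝔇.abelianScheme.DualPair)

/-- **The chart unit hypotheses of ★ FILE B / FILE A2 from the chart polarisations over reduced charts** (★
`Polarization.nonempty_unitHatSlice_iso`).
[cite: MumfordFogartyKirwan1994, Ch. 6 §2 Definitions 6.2–6.3 (p. 120)] [cite: MumfordAV1970, §5 Cor. 6 (p. 54)] -/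
theorem unit_of_isReduced [∀ i, IsReduced (𝔇.𝒰.X i)] (i : 𝔇.𝒰.I₀) :
    Nonempty ((Scheme.Modules.pullback (DualPair.unitHatSlice (𝔔.Dc i))).obj (𝔔.Dc i).P ≅ SheafOfModules.unit _) :=
  (𝔔.pol i).nonempty_unitHatSlice_iso

/-- **`hĜ` over a reduced locally Noetherian base with only `D₀`'s unit hypothesis left**: the charts `Uᵢ ↪ S` are reduced
and locally Noetherian (Mathlib `isReduced_of_isOpenImmersion`, `isLocallyNoetherian_of_isOpenImmersion`), so ★ FILE A2
`hĜ_of_isLocallyNoetherian_base` applies with the chart unit hypotheses from `unit_of_isReduced`.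
[cite: MumfordFogartyKirwan1994, Ch. 6 §1 Corollary 6.4 (p. 117) and Cor. 6.8 (p. 118)] [cite: MilneAV2008, I §8 pp. 36–37] -/
theorem hĜ_of_isReduced_of_isLocallyNoetherian [IsReduced S] [IsLocallyNoetherian S]
    (unit₀ : Nonempty ((Scheme.Modules.pullback (DualPair.unitHatSlice D₀)).obj D₀.P ≅ SheafOfModules.unit _))
    (i : 𝔇.𝒰.I₀) : (𝔔.Dc i).hat.IsBaseChangeVia D₀.hat (𝔇.𝒰.f i) (𝔔.Ĝ D₀ i) :=
  haveI : ∀ j, IsReduced (𝔇.𝒰.X j) := fun j => isReduced_of_isOpenImmersion (𝔇.𝒰.f j)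
  haveI : ∀ j, IsLocallyNoetherian (𝔇.𝒰.X j) := fun j => isLocallyNoetherian_of_isOpenImmersion (𝔇.𝒰.f j)
  𝔔.hĜ_of_isLocallyNoetherian_base D₀ unit₀ 𝔔.unit_of_isReduced i

/-- **The chart clause of the glued polarisation over a reduced locally Noetherian base** (FILE B `pol_lam_left_comp_Ĝ` on
`hĜ_of_isReduced_of_isLocallyNoetherian`): `λᵢ ≫ Ĝᵢ = χᵢ ≫ λ` for the glued `λ` of
`𝔔.toPolarizationDatum D₀ (𝔔.hĜ_of_isReduced_of_isLocallyNoetherian D₀ unit₀)`. [cite: MumfordFogartyKirwan1994, Ch. 7 §2 Definition 7.3 (p. 129)] -/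
theorem pol_lam_left_comp_Ĝ_of_isReduced [IsReduced S] [IsLocallyNoetherian S]
    (unit₀ : Nonempty ((Scheme.Modules.pullback (DualPair.unitHatSlice D₀)).obj D₀.P ≅ SheafOfModules.unit _))
    (i : 𝔇.𝒰.I₀) :
    (𝔔.pol i).lam.left ≫ 𝔔.Ĝ D₀ i =
      𝔇.χ i ≫ (𝔔.toPolarizationDatum D₀ (𝔔.hĜ_of_isReduced_of_isLocallyNoetherian D₀ unit₀)).polarization.lam.left :=
  𝔔.pol_lam_left_comp_Ĝ D₀ (𝔔.hĜ_of_isReduced_of_isLocallyNoetherian D₀ unit₀) i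

end PolarizationChartDatum

end ZariskiGluingDatum

/-! ### §2 Over a cocycle of the base: the glued triple needs only `unit₀` -/

namespace CocycleDatum

open scoped MonObj
open Literature.AlgebraicGeometry.ModuliOfAbelianVarieties (IsPolarizationType)

variable {D : Scheme.GlueData.{u}} (𝔊 : CocycleDatum D) (Dc : ∀ i, (𝔊.A i).DualPair)
  (pol : ∀ i, (𝔊.A i).Polarization (Dc i))

include pol in
/-- **The slice unit hypotheses `𝒫ᵢ|_{Aᵢ × {ε_{Âᵢ}}} ≅ 𝒪` from the slice polarisations over REDUCED slices** (★
`Polarization.nonempty_unitHatSlice_iso`). [cite: MumfordAV1970, §5 Cor. 6 (p. 54)]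
[cite: MumfordFogartyKirwan1994, Ch. 6 §2 Definition 6.3 (p. 120)] -/
theorem unit_of_isReduced [∀ i, IsReduced (D.U i)] (i : D.J) :
    Nonempty ((Scheme.Modules.pullback (DualPair.unitHatSlice (Dc i))).obj (Dc i).P ≅ SheafOfModules.unit _) :=
  (pol i).nonempty_unitHatSlice_iso

/-- The slices of a REDUCED glued scheme are reduced (open subschemes). [cite: StacksProject, Tag 01LH] -/
theorem isReduced_U (D : Scheme.GlueData.{u}) [IsReduced D.glued] (i : D.J) : IsReduced (D.U i) :=
  isReduced_of_isOpenImmersion (D.ι i)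

/-- The slices of a LOCALLY NOETHERIAN glued scheme are locally Noetherian (open subschemes). [cite: StacksProject, Tag 01LH] -/
theorem isLocallyNoetherian_U (D : Scheme.GlueData.{u}) [IsLocallyNoetherian D.glued] (i : D.J) :
    IsLocallyNoetherian (D.U i) :=
  isLocallyNoetherian_of_isOpenImmersion (D.ι i)

variable (θhat : ∀ i j, ((Dc i).baseChange (D.f i j)).hat.X.left ⟶ ((Dc j).baseChange (D.f j i)).hat.X.left)
  (hθhat : ∀ i j, ∃ (wG : ((𝔊.A i).baseChange (D.f i j)).X.hom ≫ D.t i j =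
      𝔊.θ i j ≫ ((𝔊.A j).baseChange (D.f j i)).X.hom)
    (wĜ : ((Dc i).baseChange (D.f i j)).hat.X.hom ≫ D.t i j = θhat i j ≫ ((Dc j).baseChange (D.f j i)).hat.X.hom),
    Nonempty ((Scheme.Modules.pullback (pullback.map ((𝔊.A i).baseChange (D.f i j)).X.hom
      ((Dc i).baseChange (D.f i j)).hat.X.hom ((𝔊.A j).baseChange (D.f j i)).X.hom
      ((Dc j).baseChange (D.f j i)).hat.X.hom (𝔊.θ i j) (θhat i j) (D.t i j) wG wĜ)).obj
        ((Dc j).baseChange (D.f j i)).P ≅ ((Dc i).baseChange (D.f i j)).P))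
  (hlam : ∀ i j, ((pol i).baseChange (D.f i j)).lam.left ≫ θhat i j =
    𝔊.θ i j ≫ ((pol j).baseChange (D.f j i)).lam.left)
  (D₀ : 𝔊.abelianScheme.DualPair) {g N : ℕ} {δ : Fin g → ℕ} (φ : ∀ i, (𝔊.A i).LevelStructure g N)
  (hφ : ∀ i j, ((φ i).baseChange (D.f i j)).IsBaseChangeVia ((φ j).baseChange (D.f j i)) (D.t i j) (𝔊.θ i j))
  (hrel : ∀ i, (𝔊.A i).IsOfRelDim g) (hδ : IsPolarizationType δ) (hT : ∀ i, (pol i).HasType δ)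
  (hsym : ∀ i, (φ i).IsSymplecticLiftable (pol i) δ) [∀ i, IsLocallyNoetherian (D.U i)] [∀ i, IsReduced (D.U i)]
  (unit₀ : Nonempty ((Scheme.Modules.pullback (DualPair.unitHatSlice D₀)).obj D₀.P ≅ SheafOfModules.unit _))

/-- **Every slice polarisation is the restriction of the glued one, over reduced locally Noetherian slices with only
`unit₀`** (★ FILE C `pol_lam_left_comp_Ĝ` on `unit_of_isReduced`). [cite: MumfordFogartyKirwan1994, Ch. 7 §2 Definition 7.2 (p. 129)] -/
theorem pol_lam_left_comp_Ĝ_of_isReduced (i : D.J) :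
    (pol i).lam.left ≫ 𝔊.Ĝ Dc pol θhat hθhat hlam D₀ i =
      𝔊.total.ι i ≫ (𝔊.polarization Dc pol θhat hθhat hlam D₀ unit₀ (𝔊.unit_of_isReduced Dc pol)).lam.left :=
  𝔊.pol_lam_left_comp_Ĝ Dc pol θhat hθhat hlam D₀ unit₀ (𝔊.unit_of_isReduced Dc pol) i

/-- **CARTESIAN CHARTS of the glued triple over reduced locally Noetherian slices, with only the normalisation `unit₀` of
`𝒫₀` as hypothesis** (★ FILE C `isBaseChangeVia_chartTriple` on `unit_of_isReduced`): every slice triple is the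
pull-back of `𝔊.glueTriple … unit₀ (𝔊.unit_of_isReduced Dc pol)` along `Uᵢ ↪ A⁰` (all five clauses of ★
`PolarizedAbelianSchemeWithLevel.IsBaseChangeVia`). [cite: MumfordFogartyKirwan1994, Ch. 7 §2 Definition 7.2 (p. 129)]
[cite: StacksProject, Tag 01LH] -/
theorem isBaseChangeVia_chartTriple_of_isReduced (i : D.J) :
    (𝔊.chartTriple Dc pol φ hrel hT hsym (𝔊.unit_of_isReduced Dc pol) i).IsBaseChangeVia
      (𝔊.glueTriple Dc pol θhat hθhat hlam D₀ φ hφ hrel hδ hT hsym unit₀ (𝔊.unit_of_isReduced Dc pol)) (D.ι i)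
      (𝔊.total.ι i) (𝔊.Ĝ Dc pol θhat hθhat hlam D₀ i) :=
  𝔊.isBaseChangeVia_chartTriple Dc pol θhat hθhat hlam D₀ φ hφ hrel hδ hT hsym unit₀ (𝔊.unit_of_isReduced Dc pol) i

end CocycleDatum

end AbelianSchemeOver

end Literature.AlgebraicGeometry.AbelianSchemes

end
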